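import Summits.CriticalPhenomena.PercolationContinuityZ3.Theorems.PercNearOneGluingNoHeavyLowerTailSahiChainTriangleE6
import Mathlib.Tactic.Linarith
import Mathlib.Tactic.Ring
import HarnessLib

/-!
# `NoHeavyLowerTail` (crux stmt-CriticalPhenomena-4575), P2 — chain triangle, part 3/4: the gluing patterns `τ(W)` and the clone expansions

Memo SAHI-ROUTE.md §4.17 (seat `prim-masterthm-p2`, gen 5; `--supports stmt-CriticalPhenomena-4575`).  No `sorry`, no named facts, standard axioms.

THE THEOREM (file `…SahiChainTriangle`): for probability weights `wA, wB, wC` on three finite LINEAR orders `α, β, γ` and nonnegative coordinatewise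
increasing `f : γ → α → ℝ`, `g : γ → β → ℝ`, `h : α → β → ℝ` (a "triangle": each function sees two of three independent chains), under the product weight
on `α × β × γ`:  `2·E_3(f,g,h) ≥ P_A + P_B + P_C ≥ 0`, `P_C = Σ_{a,b} wA wB h·Cov_c(f(·,a),g(·,b))` etc.; in particular Sahi's `C_3` holds for this class
(Lieb–Sahi [LiebSahi2021, Thm 3.7] is the square — two chains; three chains are open in general).  PROOF: two independent clones per chain,
`8P_X = E[S_X]`, `8(ΣP − E_3) = E[Δ²fΔ²gΔ²h]`, and the POINTWISE inequality `S_A+S_B+S_C ≥ 2Δ²fΔ²gΔ²h` on chains.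

This part: the eight gluing patterns `τ(W)`, `W ⊆ {A,B,C}` (`tauABC`, …, `tau0`: `E[fgh]` with the chains in `W` shared and independent copies off `W`),
and the expansions `E[S_C] = 8(τ(ABC) − τ(AB))`, `E[S_A] = 8(τ(ABC) − τ(BC))`, `E[S_B] = 8(τ(ABC) − τ(AC))`,
`E[Δ²fΔ²gΔ²h] = 8(τ(ABC) − τ(AB) − τ(AC) − τ(BC) + τ(A) + τ(B) + τ(C) − τ(∅))` (the triangle interaction).
-/

noncomputable section

open scoped Classical

namespace Summit.CriticalPhenomena.PercolationContinuityZ3.Theorems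

namespace SahiChainTriangle

open Finset
open Literature.Combinatorics.Sahi2008

/-! ### The gluing patterns `τ(W)` and the clone expansions -/

section Expansion

variable {α β γ : Type} [Fintype α] [Fintype β] [Fintype γ]
  (wA : α → ℝ) (wB : β → ℝ) (wC : γ → ℝ) (f : γ → α → ℝ) (g : γ → β → ℝ) (h : α → β → ℝ)

/-- `τ(ABC) = E[f g h]` (all three chains shared). [this work] -/
def tauABC : ℝ := E6 wA wB wC fun a _ b _ c _ => f c a * g c b * h a b
/-- `τ(AB)`: `f,g` see different copies of the `γ`-chain. [this work] -/
def tauAB : ℝ := E6 wA wB wC fun a _ b _ c c' => f c a * g c' b * h a b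
/-- `τ(AC)`: `g,h` see different copies of the `β`-chain. [this work] -/
def tauAC : ℝ := E6 wA wB wC fun a _ b b' c _ => f c a * g c b * h a b'
/-- `τ(BC)`: `f,h` see different copies of the `α`-chain. [this work] -/
def tauBC : ℝ := E6 wA wB wC fun a a' b _ c _ => f c a * g c b * h a' b
/-- `τ(A)`: only the `α`-chain is shared (by `f,h`). [this work] -/
def tauA : ℝ := E6 wA wB wC fun a _ b b' c c' => f c a * g c' b * h a b'
/-- `τ(B)`: only the `β`-chain is shared (by `g,h`). [this work] -/
def tauB : ℝ := E6 wA wB wC fun a a' b _ c c' => f c a * g c' b * h a' b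
/-- `τ(C)`: only the `γ`-chain is shared (by `f,g`). [this work] -/
def tauC : ℝ := E6 wA wB wC fun a a' b b' c _ => f c a * g c b * h a' b'
/-- `τ(∅)`: nothing shared. [this work] -/
def tau0 : ℝ := E6 wA wB wC fun a a' b b' c c' => f c a * g c' b * h a' b'

/-- **`E[S_C] = 8(τ(ABC) − τ(AB))`.** [this work] -/
theorem esum_SC :
    E6 wA wB wC (fun a a' b b' c c' =>
      h a b * ((f c a - f c' a) * (g c b - g c' b)) + h a b' * ((f c a - f c' a) * (g c b' - g c' b'))
        + h a' b * ((f c a' - f c' a') * (g c b - g c' b)) + h a' b' * ((f c a' - f c' a') * (g c b' - g c' b'))) =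
      8 * (tauABC wA wB wC f g h - tauAB wA wB wC f g h) := by
  set T1 : α → α → β → β → γ → γ → ℝ := fun a a' b b' c c' => h a b * ((f c a - f c' a) * (g c b - g c' b)) with hT1
  have h2 : E6 wA wB wC (fun a a' b b' c c' => h a b' * ((f c a - f c' a) * (g c b' - g c' b'))) = E6 wA wB wC T1 :=
    E6_swap_b wA wB wC T1
  have h3 : E6 wA wB wC (fun a a' b b' c c' => h a' b * ((f c a' - f c' a') * (g c b - g c' b))) = E6 wA wB wC T1 :=
    E6_swap_a wA wB wC T1
  have h4 : E6 wA wB wC (fun a a' b b' c c' => h a' b' * ((f c a' - f c' a') * (g c b' - g c' b'))) = E6 wA wB wC T1 :=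
    (E6_swap_a wA wB wC (fun a a' b b' c c' => h a b' * ((f c a - f c' a) * (g c b' - g c' b')))).trans h2
  have hsplit : E6 wA wB wC (fun a a' b b' c c' =>
      h a b * ((f c a - f c' a) * (g c b - g c' b)) + h a b' * ((f c a - f c' a) * (g c b' - g c' b'))
        + h a' b * ((f c a' - f c' a') * (g c b - g c' b)) + h a' b' * ((f c a' - f c' a') * (g c b' - g c' b'))) =
      E6 wA wB wC T1 + E6 wA wB wC (fun a a' b b' c c' => h a b' * ((f c a - f c' a) * (g c b' - g c' b')))
        + E6 wA wB wC (fun a a' b b' c c' => h a' b * ((f c a' - f c' a') * (g c b - g c' b)))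
        + E6 wA wB wC (fun a a' b b' c c' => h a' b' * ((f c a' - f c' a') * (g c b' - g c' b'))) := by
    rw [← E6_add, ← E6_add, ← E6_add]
  -- the basic term
  have m3 : E6 wA wB wC (fun a a' b b' c c' => f c' a * g c b * h a b) = tauAB wA wB wC f g h :=
    E6_swap_c wA wB wC (fun a a' b b' c c' => f c a * g c' b * h a b)
  have m4 : E6 wA wB wC (fun a a' b b' c c' => f c' a * g c' b * h a b) = tauABC wA wB wC f g h :=
    E6_swap_c wA wB wC (fun a a' b b' c c' => f c a * g c b * h a b)
  have hT : E6 wA wB wC T1 = 2 * tauABC wA wB wC f g h - 2 * tauAB wA wB wC f g h := by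
    have : E6 wA wB wC T1 = E6 wA wB wC (fun a a' b b' c c' => f c a * g c b * h a b)
        - E6 wA wB wC (fun a a' b b' c c' => f c a * g c' b * h a b)
        - E6 wA wB wC (fun a a' b b' c c' => f c' a * g c b * h a b)
        + E6 wA wB wC (fun a a' b b' c c' => f c' a * g c' b * h a b) := by
      rw [← E6_sub, ← E6_sub, ← E6_add]
      exact E6_congr wA wB wC fun _ _ _ _ _ _ => by simp only [hT1]; ring
    rw [this, m3, m4, tauABC, tauAB]; ring
  rw [hsplit, h2, h3, h4, hT]; ring

/-- **`E[S_A] = 8(τ(ABC) − τ(BC))`.** [this work] -/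
theorem esum_SA :
    E6 wA wB wC (fun a a' b b' c c' =>
      g c b * ((f c a - f c a') * (h a b - h a' b)) + g c b' * ((f c a - f c a') * (h a b' - h a' b'))
        + g c' b * ((f c' a - f c' a') * (h a b - h a' b)) + g c' b' * ((f c' a - f c' a') * (h a b' - h a' b'))) =
      8 * (tauABC wA wB wC f g h - tauBC wA wB wC f g h) := by
  set U1 : α → α → β → β → γ → γ → ℝ := fun a a' b b' c c' => g c b * ((f c a - f c a') * (h a b - h a' b)) with hU1
  have h2 : E6 wA wB wC (fun a a' b b' c c' => g c b' * ((f c a - f c a') * (h a b' - h a' b'))) = E6 wA wB wC U1 :=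
    E6_swap_b wA wB wC U1
  have h3 : E6 wA wB wC (fun a a' b b' c c' => g c' b * ((f c' a - f c' a') * (h a b - h a' b))) = E6 wA wB wC U1 :=
    E6_swap_c wA wB wC U1
  have h4 : E6 wA wB wC (fun a a' b b' c c' => g c' b' * ((f c' a - f c' a') * (h a b' - h a' b'))) = E6 wA wB wC U1 :=
    (E6_swap_c wA wB wC (fun a a' b b' c c' => g c b' * ((f c a - f c a') * (h a b' - h a' b')))).trans h2
  have hsplit : E6 wA wB wC (fun a a' b b' c c' =>
      g c b * ((f c a - f c a') * (h a b - h a' b)) + g c b' * ((f c a - f c a') * (h a b' - h a' b'))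
        + g c' b * ((f c' a - f c' a') * (h a b - h a' b)) + g c' b' * ((f c' a - f c' a') * (h a b' - h a' b'))) =
      E6 wA wB wC U1 + E6 wA wB wC (fun a a' b b' c c' => g c b' * ((f c a - f c a') * (h a b' - h a' b')))
        + E6 wA wB wC (fun a a' b b' c c' => g c' b * ((f c' a - f c' a') * (h a b - h a' b)))
        + E6 wA wB wC (fun a a' b b' c c' => g c' b' * ((f c' a - f c' a') * (h a b' - h a' b'))) := by
    rw [← E6_add, ← E6_add, ← E6_add]
  have m3 : E6 wA wB wC (fun a a' b b' c c' => f c a' * g c b * h a b) = tauBC wA wB wC f g h :=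
    E6_swap_a wA wB wC (fun a a' b b' c c' => f c a * g c b * h a' b)
  have m4 : E6 wA wB wC (fun a a' b b' c c' => f c a' * g c b * h a' b) = tauABC wA wB wC f g h :=
    E6_swap_a wA wB wC (fun a a' b b' c c' => f c a * g c b * h a b)
  have hU : E6 wA wB wC U1 = 2 * tauABC wA wB wC f g h - 2 * tauBC wA wB wC f g h := by
    have : E6 wA wB wC U1 = E6 wA wB wC (fun a a' b b' c c' => f c a * g c b * h a b)
        - E6 wA wB wC (fun a a' b b' c c' => f c a * g c b * h a' b)
        - E6 wA wB wC (fun a a' b b' c c' => f c a' * g c b * h a b)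
        + E6 wA wB wC (fun a a' b b' c c' => f c a' * g c b * h a' b) := by
      rw [← E6_sub, ← E6_sub, ← E6_add]
      exact E6_congr wA wB wC fun _ _ _ _ _ _ => by simp only [hU1]; ring
    rw [this, m3, m4, tauABC, tauBC]; ring
  rw [hsplit, h2, h3, h4, hU]; ring

/-- **`E[S_B] = 8(τ(ABC) − τ(AC))`.** [this work] -/
theorem esum_SB :
    E6 wA wB wC (fun a a' b b' c c' =>
      f c a * ((g c b - g c b') * (h a b - h a b')) + f c a' * ((g c b - g c b') * (h a' b - h a' b'))
        + f c' a * ((g c' b - g c' b') * (h a b - h a b')) + f c' a' * ((g c' b - g c' b') * (h a' b - h a' b'))) =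
      8 * (tauABC wA wB wC f g h - tauAC wA wB wC f g h) := by
  set V1 : α → α → β → β → γ → γ → ℝ := fun a a' b b' c c' => f c a * ((g c b - g c b') * (h a b - h a b')) with hV1
  have h2 : E6 wA wB wC (fun a a' b b' c c' => f c a' * ((g c b - g c b') * (h a' b - h a' b'))) = E6 wA wB wC V1 :=
    E6_swap_a wA wB wC V1
  have h3 : E6 wA wB wC (fun a a' b b' c c' => f c' a * ((g c' b - g c' b') * (h a b - h a b'))) = E6 wA wB wC V1 :=
    E6_swap_c wA wB wC V1
  have h4 : E6 wA wB wC (fun a a' b b' c c' => f c' a' * ((g c' b - g c' b') * (h a' b - h a' b'))) = E6 wA wB wC V1 :=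
    (E6_swap_c wA wB wC (fun a a' b b' c c' => f c a' * ((g c b - g c b') * (h a' b - h a' b')))).trans h2
  have hsplit : E6 wA wB wC (fun a a' b b' c c' =>
      f c a * ((g c b - g c b') * (h a b - h a b')) + f c a' * ((g c b - g c b') * (h a' b - h a' b'))
        + f c' a * ((g c' b - g c' b') * (h a b - h a b')) + f c' a' * ((g c' b - g c' b') * (h a' b - h a' b'))) =
      E6 wA wB wC V1 + E6 wA wB wC (fun a a' b b' c c' => f c a' * ((g c b - g c b') * (h a' b - h a' b')))
        + E6 wA wB wC (fun a a' b b' c c' => f c' a * ((g c' b - g c' b') * (h a b - h a b')))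
        + E6 wA wB wC (fun a a' b b' c c' => f c' a' * ((g c' b - g c' b') * (h a' b - h a' b'))) := by
    rw [← E6_add, ← E6_add, ← E6_add]
  have m3 : E6 wA wB wC (fun a a' b b' c c' => f c a * g c b' * h a b) = tauAC wA wB wC f g h :=
    E6_swap_b wA wB wC (fun a a' b b' c c' => f c a * g c b * h a b')
  have m4 : E6 wA wB wC (fun a a' b b' c c' => f c a * g c b' * h a b') = tauABC wA wB wC f g h :=
    E6_swap_b wA wB wC (fun a a' b b' c c' => f c a * g c b * h a b)
  have hV : E6 wA wB wC V1 = 2 * tauABC wA wB wC f g h - 2 * tauAC wA wB wC f g h := by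
    have : E6 wA wB wC V1 = E6 wA wB wC (fun a a' b b' c c' => f c a * g c b * h a b)
        - E6 wA wB wC (fun a a' b b' c c' => f c a * g c b * h a b')
        - E6 wA wB wC (fun a a' b b' c c' => f c a * g c b' * h a b)
        + E6 wA wB wC (fun a a' b b' c c' => f c a * g c b' * h a b') := by
      rw [← E6_sub, ← E6_sub, ← E6_add]
      exact E6_congr wA wB wC fun _ _ _ _ _ _ => by simp only [hV1]; ring
    rw [this, m3, m4, tauABC, tauAC]; ring
  rw [hsplit, h2, h3, h4, hV]; ring

/-- **`E[Δ²f·Δ²g·Δ²h] = 8(τ(ABC) − τ(AB) − τ(AC) − τ(BC) + τ(A) + τ(B) + τ(C) − τ(∅)) = 8·I`** (the triangle interaction). [this work] -/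
theorem esum_D :
    E6 wA wB wC (fun a a' b b' c c' =>
      (h a b - h a' b - h a b' + h a' b') * ((f c a - f c' a - f c a' + f c' a') * (g c b - g c' b - g c b' + g c' b'))) =
      8 * (tauABC wA wB wC f g h - tauAB wA wB wC f g h - tauAC wA wB wC f g h - tauBC wA wB wC f g h
        + tauA wA wB wC f g h + tauB wA wB wC f g h + tauC wA wB wC f g h - tau0 wA wB wC f g h) := by
  -- step (c): reduce to D1 := Δh · (f c a − f c a') · (g c b − g c b' − g c' b + g c' b')
  set Dcc : α → α → β → β → γ → γ → ℝ := fun a a' b b' c c' =>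
    (h a b - h a' b - h a b' + h a' b') * ((f c a - f c a') * (g c b - g c b')) with hDcc
  set Dcx : α → α → β → β → γ → γ → ℝ := fun a a' b b' c c' =>
    (h a b - h a' b - h a b' + h a' b') * ((f c a - f c a') * (g c' b - g c' b')) with hDcx
  have sc1 : E6 wA wB wC (fun a a' b b' c c' => (h a b - h a' b - h a b' + h a' b') * ((f c' a - f c' a') * (g c' b - g c' b'))) =
      E6 wA wB wC Dcc := E6_swap_c wA wB wC Dcc
  have sc2 : E6 wA wB wC (fun a a' b b' c c' => (h a b - h a' b - h a b' + h a' b') * ((f c' a - f c' a') * (g c b - g c b'))) =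
      E6 wA wB wC Dcx := E6_swap_c wA wB wC Dcx
  have stepc : E6 wA wB wC (fun a a' b b' c c' =>
      (h a b - h a' b - h a b' + h a' b') * ((f c a - f c' a - f c a' + f c' a') * (g c b - g c' b - g c b' + g c' b'))) =
      2 * (E6 wA wB wC Dcc - E6 wA wB wC Dcx) := by
    have : E6 wA wB wC (fun a a' b b' c c' =>
        (h a b - h a' b - h a b' + h a' b') * ((f c a - f c' a - f c a' + f c' a') * (g c b - g c' b - g c b' + g c' b'))) =
        E6 wA wB wC Dcc - E6 wA wB wC Dcx
        - E6 wA wB wC (fun a a' b b' c c' => (h a b - h a' b - h a b' + h a' b') * ((f c' a - f c' a') * (g c b - g c b')))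
        + E6 wA wB wC (fun a a' b b' c c' => (h a b - h a' b - h a b' + h a' b') * ((f c' a - f c' a') * (g c' b - g c' b'))) := by
      rw [← E6_sub, ← E6_sub, ← E6_add]
      exact E6_congr wA wB wC fun _ _ _ _ _ _ => by simp only [hDcc, hDcx]; ring
    rw [this, sc1, sc2]; ring
  -- step (a): Dcc − Dcx = D1 = (f c a − f c a')(η a − η a') R ; reduce to D2 := f c a · (η a − η a') · R
  set Waa : α → α → β → β → γ → γ → ℝ := fun a a' b b' c c' =>
    f c a * (h a b - h a b') * (g c b - g c b' - g c' b + g c' b') with hWaa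
  set Wax : α → α → β → β → γ → γ → ℝ := fun a a' b b' c c' =>
    f c a * (h a' b - h a' b') * (g c b - g c b' - g c' b + g c' b') with hWax
  have sa1 : E6 wA wB wC (fun a a' b b' c c' => f c a' * (h a' b - h a' b') * (g c b - g c b' - g c' b + g c' b')) =
      E6 wA wB wC Waa := E6_swap_a wA wB wC Waa
  have sa2 : E6 wA wB wC (fun a a' b b' c c' => f c a' * (h a b - h a b') * (g c b - g c b' - g c' b + g c' b')) =
      E6 wA wB wC Wax := E6_swap_a wA wB wC Wax
  have stepa : E6 wA wB wC Dcc - E6 wA wB wC Dcx = 2 * (E6 wA wB wC Waa - E6 wA wB wC Wax) := by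
    have : E6 wA wB wC Dcc - E6 wA wB wC Dcx =
        E6 wA wB wC Waa - E6 wA wB wC Wax
        - E6 wA wB wC (fun a a' b b' c c' => f c a' * (h a b - h a b') * (g c b - g c b' - g c' b + g c' b'))
        + E6 wA wB wC (fun a a' b b' c c' => f c a' * (h a' b - h a' b') * (g c b - g c b' - g c' b + g c' b')) := by
      rw [← E6_sub, ← E6_sub, ← E6_sub, ← E6_add]
      exact E6_congr wA wB wC fun _ _ _ _ _ _ => by simp only [hDcc, hDcx, hWaa, hWax]; ring
    rw [this, sa1, sa2]; ring
  -- step (b): Waa − Wax = f c a (κ b − κ b')(λ b − λ b'); reduce to D3 := f c a · (h a b − h a' b) · (g c b − g c' b − g c b' + g c' b')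
  set Zbb : α → α → β → β → γ → γ → ℝ := fun a a' b b' c c' => f c a * (h a b - h a' b) * (g c b - g c' b) with hZbb
  set Zbx : α → α → β → β → γ → γ → ℝ := fun a a' b b' c c' => f c a * (h a b - h a' b) * (g c b' - g c' b') with hZbx
  have sb1 : E6 wA wB wC (fun a a' b b' c c' => f c a * (h a b' - h a' b') * (g c b' - g c' b')) = E6 wA wB wC Zbb :=
    E6_swap_b wA wB wC Zbb
  have sb2 : E6 wA wB wC (fun a a' b b' c c' => f c a * (h a b' - h a' b') * (g c b - g c' b)) = E6 wA wB wC Zbx :=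
    E6_swap_b wA wB wC Zbx
  have stepb : E6 wA wB wC Waa - E6 wA wB wC Wax = 2 * (E6 wA wB wC Zbb - E6 wA wB wC Zbx) := by
    have : E6 wA wB wC Waa - E6 wA wB wC Wax =
        E6 wA wB wC Zbb - E6 wA wB wC Zbx
        - E6 wA wB wC (fun a a' b b' c c' => f c a * (h a b' - h a' b') * (g c b - g c' b))
        + E6 wA wB wC (fun a a' b b' c c' => f c a * (h a b' - h a' b') * (g c b' - g c' b')) := by
      rw [← E6_sub, ← E6_sub, ← E6_sub, ← E6_add]
      exact E6_congr wA wB wC fun _ _ _ _ _ _ => by simp only [hWaa, hWax, hZbb, hZbx]; ring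
    rw [this, sb1, sb2]; ring
  -- expand Zbb − Zbx into the eight gluing patterns
  have p3 : E6 wA wB wC (fun a a' b b' c c' => f c a * g c b' * h a b) = tauAC wA wB wC f g h :=
    E6_swap_b wA wB wC (fun a a' b b' c c' => f c a * g c b * h a b')
  have p4 : E6 wA wB wC (fun a a' b b' c c' => f c a * g c' b' * h a b) = tauA wA wB wC f g h :=
    E6_swap_b wA wB wC (fun a a' b b' c c' => f c a * g c' b * h a b')
  have p7 : E6 wA wB wC (fun a a' b b' c c' => f c a * g c b' * h a' b) = tauC wA wB wC f g h :=
    E6_swap_b wA wB wC (fun a a' b b' c c' => f c a * g c b * h a' b')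
  have p8 : E6 wA wB wC (fun a a' b b' c c' => f c a * g c' b' * h a' b) = tau0 wA wB wC f g h :=
    E6_swap_b wA wB wC (fun a a' b b' c c' => f c a * g c' b * h a' b')
  have final : E6 wA wB wC Zbb - E6 wA wB wC Zbx =
      tauABC wA wB wC f g h - tauAB wA wB wC f g h - tauAC wA wB wC f g h - tauBC wA wB wC f g h
        + tauA wA wB wC f g h + tauB wA wB wC f g h + tauC wA wB wC f g h - tau0 wA wB wC f g h := by
    have expand : E6 wA wB wC Zbb - E6 wA wB wC Zbx = E6 wA wB wC (fun a a' b b' c c' =>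
        f c a * g c b * h a b - f c a * g c' b * h a b - f c a * g c b' * h a b - f c a * g c b * h a' b
          + f c a * g c' b' * h a b + f c a * g c' b * h a' b + f c a * g c b' * h a' b - f c a * g c' b' * h a' b) := by
      rw [← E6_sub]
      exact E6_congr wA wB wC fun _ _ _ _ _ _ => by simp only [hZbb, hZbx]; ring
    rw [expand]
    simp only [E6_sub, E6_add]
    rw [p3, p4, p7, p8]
    simp only [tauABC, tauAB, tauBC, tauB]
  rw [stepc, stepa, stepb, final]; ring

end Expansion

end SahiChainTriangle

end Summit.CriticalPhenomena.PercolationContinuityZ3.Theorems
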